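import Literature.Computability.Complexity.HiraharaMachineEval
import Literature.Computability.Complexity.FPStringBricks
import HarnessLib

/-!
# The machine of Hirahara's reduction, VI: the main output on codes

Topic `Computability/Complexity`. The list-level main output `mainOutT` of part IV is computed by
a polynomial-time string function on the code `(tuple, coins)` (`codeFP_mainOutT`), assembled in
the typed `CodeFP` algebra from the parameters (part II), the capped greedy codes (part III) and
generic list combinators; every enumeration runs within the budget `budgetT` (a polynomial of the
size measure, itself produced in unary by `unitsPow`).

## References

* S. Hirahara, *NP-hardness of learning programs and partial MCSP*, ECCC TR22-119, proofs of
  Lemma 8.3 and Thm. 8.5 ("a randomized polynomial-time reduction") [Hirahara2022PartialMCSP].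
* S. Arora, B. Barak, *Computational Complexity: A Modern Approach*, CUP 2009, §1.2–1.3.
-/

namespace Literature.Computability.Complexity

open _root_.Computability Polynomial Brick
open Literature.Computability.MetaComplexity (MonotoneDNF)
open CSPToCMMSAMachine (TO toE)
open CodeFP

namespace HiraharaMachine

/-! The parameters with large literal exponents or addends must never be unfolded by the unifier
(a `whnf` of `2^{4096·4^{143}}` or `x + 4096` recurses on the literal); they are irreducible here. -/
attribute [local irreducible] budgetT logLamT lamT dNWT sPT LxT kAT mIT

/-! ### Generic helpers -/

/-- Product of unary numerals (through unit budgets; local helper). [folklore] -/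
private theorem unMul : CodeFP (pairE unE unE) unE (fun p => p.1 * p.2) :=
  ((ulength unitE).comp (unitsMul.comp ((replicateUnit.comp (fst unE unE)).pair (replicateUnit.comp (snd unE unE))))).congr
    fun p => by simp

/-- **Reading a bit of a string at a unary position** (default `false` past the end). [cite: AroraBarak2009, §1.3] -/
private theorem bitRead : CodeFP (pairE unE strE) bitE (fun p => p.2.getD p.1 false) := by
  refine ⟨iteFn isNilFn (fun _ => [false]) id ∘ bitAtFn,
    comp_mem_FP (iteFn_mem_FP isNilFn_mem_FP (const_mem_FP _) (PolyTimeComputable.id _)) bitAtFn_mem_FP, fun p => ?_⟩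
  obtain ⟨i, r⟩ := p
  rw [pairE_apply, Function.comp_apply]
  change iteFn isNilFn (fun _ => [false]) id (bitAtFn (boolPair (unE i) r)) = bitE (r.getD i false)
  rw [bitAtFn_boolPair, length_unE]
  rcases lt_or_ge i r.length with h | h
  · rw [List.take_one_drop_eq_of_lt_length h, iteFn_apply (b := false) (by rfl)]
    change [r[i]] = bitE (r.getD i false)
    rw [List.getD_eq_getElem _ _ h]; rfl
  · rw [List.drop_eq_nil_of_le h, List.take_nil, iteFn_apply (b := true) (by rfl)]
    change [false] = bitE (r.getD i false)
    rw [List.getD_eq_default _ _ h]; rfl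

/-- **Reading a bit of a string at a binary position** (default `false` past the end): the
position is capped by the length first. [cite: AroraBarak2009, §1.3] -/
private theorem bitReadNat : CodeFP (pairE natE strE) bitE (fun p => p.2.getD p.1 false) := by
  have hpos : CodeFP (pairE natE strE) unE (fun p => min p.1 p.2.length) :=
    (unOfNatMin.comp ((strLength.comp (snd _ _)).pair (fst _ _)) :)
  exact (bitRead.comp (hpos.pair (snd _ _))).congr fun p => by
    rcases le_or_gt p.1 p.2.length with h | h
    · rw [min_eq_left h]
    · rw [min_eq_right h.le, List.getD_eq_default _ _ le_rfl, List.getD_eq_default _ _ h.le]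

/-- **Parity** of a raw bit list. [folklore] -/
private theorem codeFP_parityT : CodeFP (rawE bitE) bitE parityT := by
  have h := foldl₀ (eα := bitE) (step := fun (b : Bool) (acc : Bool) => xor acc b) (b₀ := false)
    (xorBit.comp ((snd _ _).pair (fst _ _))) 1 (fun l₁ l₂ => by simp [bitE])
  exact h.congr fun l => rfl

/-- The value fold. [folklore] -/
private theorem foldl_valStep (l : List Bool) (a pw : ℕ) :
    (l.foldl (fun (st : ℕ × ℕ) b => (st.1 + (if b then st.2 else 0), 2 * st.2)) (a, pw)) = (a + pw * valT l, pw * 2 ^ l.length) := by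
  induction l generalizing a pw with
  | nil => simp [valT]
  | cons b l ih =>
    rw [List.foldl_cons, ih, valT, Nat.bit_val, List.length_cons, pow_succ]
    refine Prod.ext ?_ ?_
    · cases b <;> simp <;> ring
    · simp only; ring

/-- **The binary value** of a raw bit list (least significant bit first). [folklore] -/
private theorem codeFP_valT : CodeFP (rawE bitE) natE valT := by
  have hA : CodeFP (pairE bitE (pairE natE natE)) natE (fun q => q.2.1) := (snd _ _).fst'
  have hP : CodeFP (pairE bitE (pairE natE natE)) natE (fun q => q.2.2) := (snd _ _).snd'
  have hstep : CodeFP (pairE bitE (pairE natE natE)) (pairE natE natE) (fun q => (q.2.1 + (if q.1 then q.2.2 else 0), 2 * q.2.2)) :=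
    ((natAdd.comp (hA.pair ((fst _ _).ite hP (const _ (0 : ℕ))))).pair (natMul.comp ((const _ (2 : ℕ)).pair hP)) :)
  have h := foldl₀ (eα := bitE) (step := fun (b : Bool) (st : ℕ × ℕ) => (st.1 + (if b then st.2 else 0), 2 * st.2))
    (b₀ := ((0 : ℕ), (1 : ℕ))) hstep (6 * X + 8) (fun l₁ l₂ => by
      rw [foldl_valStep, zero_add, one_mul, one_mul, pairE_apply, length_boolPair, CodeFP.length_natE, CodeFP.length_natE]
      simp only [eval_add, eval_mul, eval_ofNat, eval_X]
      have h1 : Nat.size (valT l₁) ≤ l₁.length := Nat.size_le.2 (valT_lt_pow l₁)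
      have h2 : Nat.size (2 ^ l₁.length) ≤ l₁.length + 1 := by rw [Nat.size_pow]
      have h3 : l₁.length ≤ (rawE bitE (l₁ ++ l₂)).length := le_trans (by simp) (length_le_length_rawE bitE (l₁ ++ l₂))
      omega)
  exact (h.fst'.congr fun l => by rw [foldl_valStep]; simp)
where
  /-- `valT v < 2^{|v|}` (restated for this file). [folklore] -/
  valT_lt_pow : ∀ v : List Bool, valT v < 2 ^ v.length
  | [] => by simp [valT]
  | b :: v => by
    rw [valT, List.length_cons, Nat.bit_val, pow_succ]
    have := valT_lt_pow v
    cases b <;> simp <;> omega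

/-- Reversal preserves the length of the raw code. [folklore] -/
private theorem length_rawE_reverse {α : Type} (eα : α → List Bool) (l : List α) : (rawE eα l.reverse).length = (rawE eα l).length := by
  rw [length_rawE, length_rawE, List.map_reverse, List.sum_reverse]

/-- **Reversal** of a raw list. [folklore] -/
private theorem codeFP_reverse {α : Type} (eα : α → List Bool) : CodeFP (rawE eα) (rawE eα) List.reverse := by
  have h := foldl₀ (eα := eα) (step := fun (a : α) (acc : List α) => a :: acc) (b₀ := [])
    (rawCons eα) X (fun l₁ l₂ => by
      have : ∀ (l : List α) (acc : List α), l.foldl (fun acc a => a :: acc) acc = l.reverse ++ acc := by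
        intro l; induction l with
        | nil => simp
        | cons a l ih => intro acc; rw [List.foldl_cons, ih]; simp
      rw [this, List.append_nil, eval_X, length_rawE_reverse]
      exact length_rawE_le_of_sublist eα (List.sublist_append_left l₁ l₂))
  exact h.congr fun l => by
    have : ∀ (l : List α) (acc : List α), l.foldl (fun acc a => a :: acc) acc = l.reverse ++ acc := by
      intro l; induction l with
      | nil => simp
      | cons a l ih => intro acc; rw [List.foldl_cons, ih]; simp
    rw [this, List.append_nil]

/-- `dedup` as a right fold. [folklore] -/
private theorem dedup_eq_foldr (l : List ℕ) : l.dedup = l.foldr (fun a acc => if a ∈ acc then acc else a :: acc) [] := by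
  induction l with
  | nil => rfl
  | cons a l ih => rw [List.foldr_cons, ← ih, List.dedup_cons']

/-- **Deduplication** of a raw list of numerals (keeping last occurrences, `List.dedup`). [folklore] -/
private theorem codeFP_dedup : CodeFP (rawE natE) (rawE natE) List.dedup := by
  have hstep : CodeFP (pairE natE (rawE natE)) (rawE natE) (fun q => if decide (q.1 ∈ q.2) then q.2 else q.1 :: q.2) :=
    ((mem natE_injective).ite (snd _ _) (rawCons natE) :)
  have hfold : ∀ (l acc : List ℕ), l.foldl (fun acc a => if decide (a ∈ acc) then acc else a :: acc) acc =
      l.reverse.foldr (fun a acc => if a ∈ acc then acc else a :: acc) acc := by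
    intro l; induction l with
    | nil => intro acc; rfl
    | cons a l ih => intro acc; rw [List.foldl_cons, ih, List.reverse_cons, List.foldr_append]; simp
  have hsub : ∀ (l acc : List ℕ), (l.foldr (fun a acc => if a ∈ acc then acc else a :: acc) acc).Sublist (l ++ acc) := by
    intro l; induction l with
    | nil => intro acc; simp
    | cons a l ih =>
      intro acc; rw [List.foldr_cons]
      split
      · exact (ih acc).trans (List.sublist_cons_self _ _)
      · exact (ih acc).cons_cons a
  have h := foldl₀ (eα := natE) (step := fun (a : ℕ) (acc : List ℕ) => if decide (a ∈ acc) then acc else a :: acc) (b₀ := [])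
    hstep X (fun l₁ l₂ => by
      rw [hfold, eval_X]
      have h1 := length_rawE_le_of_sublist natE (hsub l₁.reverse [])
      rw [List.append_nil, length_rawE_reverse] at h1
      exact h1.trans (length_rawE_le_of_sublist natE (List.sublist_append_left l₁ l₂)))
  have h' : CodeFP (rawE natE) (rawE natE) (fun l => l.reverse.dedup) := h.congr fun l => by
    rw [hfold, dedup_eq_foldr]
  exact ((h'.comp (codeFP_reverse natE)).congr fun l => by simp)

/-- **A binary digit**: `(i, p) ↦ bit_p(i)` (`i` binary, `p` unary). [folklore] -/
private theorem codeFP_testBit : CodeFP (pairE natE unE) bitE (fun q => q.1.testBit q.2) := by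
  have h : CodeFP (pairE natE unE) bitE (fun q => decide (q.1 / 2 ^ q.2 % 2 = 1)) :=
    (natEq.comp ((natMod.comp ((natDiv.comp ((fst _ _).pair (natPow.comp ((const _ (2 : ℕ)).pair (snd _ _))))).pair
      (const _ (2 : ℕ)))).pair (const _ (1 : ℕ))) :)
  exact h.congr fun q => by rw [Nat.testBit_eq_decide_div_mod_eq]

/-! ### The budget -/

/-- **The enumeration budget in unary.** [folklore] -/
theorem codeFP_budgetT : CodeFP toE unE budgetT := by
  have hs2 : CodeFP toE unE (fun t => sizeOfT t + sizeOfT t + 2) :=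
    (unAdd.comp ((unAdd.comp (codeFP_sizeOfT.pair codeFP_sizeOfT)).pair (const toE (2 : ℕ))) :)
  have hs : CodeFP toE unE (fun t => 2 * sizeOfT t + 2) := hs2.congr fun t => by omega
  have hu : CodeFP toE (rawE unitE) (fun t => List.replicate ((2 * sizeOfT t + 2) ^ (4 * 4 ^ 143)) ()) :=
    (unitsPow (4 * 4 ^ 143)).comp hs
  have hu' : CodeFP toE unE (fun t => (2 * sizeOfT t + 2) ^ (4 * 4 ^ 143)) :=
    ((ulength unitE).comp hu).congr fun t => by rw [List.length_replicate]
  have h : CodeFP toE unE (fun t => (2 * sizeOfT t + 2) ^ (4 * 4 ^ 143) * 2 ^ (4096 * 4 ^ 143)) :=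
    (unMul.comp (hu'.pair (const toE (2 ^ (4096 * 4 ^ 143) : ℕ))) :)
  exact h.congr fun t => by rw [budgetT]

/-! ### Coins -/

/-- **The coin lookup on codes**: context `(t, r)`, arguments `(k, v)`. [cite: Hirahara2022PartialMCSP, proof of Lemma 8.3] -/
theorem codeFP_coinT : CodeFP (pairE inE (pairE natE (rawE bitE))) bitE (fun p => coinT p.1.1 p.1.2 p.2.1 p.2.2) := by
  have hoff : CodeFP (pairE inE (pairE natE (rawE bitE))) natE (fun p => offT p.1.1 (min p.2.1 (nT p.1.1))) :=
    (codeFP_offT.comp ((fst _ _).fst'.pair (snd _ _).fst') :)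
  have hpos : CodeFP (pairE inE (pairE natE (rawE bitE))) natE (fun p => offT p.1.1 (min p.2.1 (nT p.1.1)) + valT p.2.2) :=
    (natAdd.comp (hoff.pair (codeFP_valT.comp (snd _ _).snd')) :)
  have h : CodeFP (pairE inE (pairE natE (rawE bitE))) bitE
      (fun p => p.1.2.getD (offT p.1.1 (min p.2.1 (nT p.1.1)) + valT p.2.2) false) :=
    (bitReadNat.comp (hpos.pair (fst _ _).snd') :)
  exact h.congr fun p => by unfold coinT; rfl

/-! ### Design positions -/

/-- Halving a unary numeral. [folklore] -/
private theorem unHalf : CodeFP unE unE (fun n => n / 2) :=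
  unOfNatCap ((natDiv.comp ((natOfUn).pair (const unE (2 : ℕ)))) :) (CodeFP.id unE) fun n => Nat.div_le_self n 2

/-- Dividing a unary numeral by `140`. [folklore] -/
private theorem unDiv140 : CodeFP unE unE (fun n => n / 140) :=
  unOfNatCap ((natDiv.comp ((natOfUn).pair (const unE (140 : ℕ)))) :) (CodeFP.id unE) fun n => Nat.div_le_self n 140

/-- **The amplification design words on codes**: `(t, k) ↦ AWT t k`. [cite: Hirahara2022PartialMCSP, proof of Lemma 8.1] -/
theorem codeFP_AWT : CodeFP (pairE toE natE) (rawE (rawE natE)) (fun p => AWT p.1 p.2) := by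
  have hN : CodeFP (pairE toE natE) unE (fun p => NT p.1 p.2) := codeFP_NT
  have h : CodeFP (pairE toE natE) (rawE (rawE natE))
      (fun p => lexWordsCapT (budgetT p.1) (NT p.1 p.2) 16 (NT p.1 p.2 / 2)) :=
    (codeFP_lexWordsCap.comp ((codeFP_budgetT.comp (fst _ _)).pair (hN.pair ((const _ (16 : ℕ)).pair (unHalf.comp hN)))) :)
  exact h.congr fun p => by unfold AWT; rfl

/-- **The amplification design positions on codes**: context `(t, k)`, arguments `(q, rr)`. [folklore] -/
theorem codeFP_eAposT : CodeFP (pairE (pairE toE natE) (pairE natE natE)) natE (fun p => eAposT p.1.1 p.1.2 p.2.1 p.2.2) := by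
  have hw : CodeFP (pairE (pairE toE natE) (pairE natE natE)) (rawE natE) (fun p => (AWT p.1.1 p.1.2).getD p.2.1 []) :=
    ((rawGetD (rawE natE) (d := []) rfl).comp ((codeFP_AWT.comp (fst _ _)).pair (snd _ _).fst') :)
  have hd : CodeFP (pairE (pairE toE natE) (pairE natE natE)) natE (fun p => ((AWT p.1.1 p.1.2).getD p.2.1 []).getD p.2.2 0) :=
    ((rawGetD natE (d := 0) rfl).comp (hw.pair (snd _ _).snd') :)
  have h : CodeFP (pairE (pairE toE natE) (pairE natE natE)) natE
      (fun p => ((AWT p.1.1 p.1.2).getD p.2.1 []).getD p.2.2 0 + 16 * p.2.2) :=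
    (natAdd.comp (hd.pair (natMul.comp ((const _ (16 : ℕ)).pair (snd _ _).snd'))) :)
  exact h.congr fun p => by unfold eAposT; rfl

/-- **The NW design words on codes.** [cite: Hirahara2022PartialMCSP, proof of Lemma 8.3] -/
theorem codeFP_EWT : CodeFP toE (rawE (rawE natE)) EWT := by
  have h : CodeFP toE (rawE (rawE natE)) (fun t => lexWordsCapT (budgetT t) (ℓT t) (4 ^ 140) (ℓT t / 140)) :=
    (codeFP_lexWordsCap.comp (codeFP_budgetT.pair (codeFP_ℓT.pair ((const _ (4 ^ 140 : ℕ)).pair (unDiv140.comp codeFP_ℓT)))) :)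
  exact h.congr fun t => by unfold EWT; rfl

/-- **The NW design positions on codes**: context `t`, arguments `(k, (tt, x))`. [folklore] -/
theorem codeFP_EposT : CodeFP (pairE toE (pairE natE (pairE natE natE))) natE (fun p => EposT p.1 p.2.1 p.2.2.1 p.2.2.2) := by
  let cE : TO × ℕ × ℕ × ℕ → List Bool := pairE toE (pairE natE (pairE natE natE))
  have hk : CodeFP cE natE (fun p => p.2.1) := (snd _ _).fst'
  have htt : CodeFP cE natE (fun p => p.2.2.1) := (snd _ _).snd'.fst'
  have hx : CodeFP cE natE (fun p => p.2.2.2) := (snd _ _).snd'.snd'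
  have hidx : CodeFP cE natE (fun p => p.2.2.1 + ΔT p.1 * p.2.1) :=
    (natAdd.comp (htt.pair (natMul.comp ((codeFP_ΔT.comp (fst _ _)).pair hk))) :)
  have hw : CodeFP cE (rawE natE) (fun p => (EWT p.1).getD (p.2.2.1 + ΔT p.1 * p.2.1) []) :=
    ((rawGetD (rawE natE) (d := []) rfl).comp ((codeFP_EWT.comp (fst _ _)).pair hidx) :)
  have hd : CodeFP cE natE (fun p => ((EWT p.1).getD (p.2.2.1 + ΔT p.1 * p.2.1) []).getD p.2.2.2 0) :=
    ((rawGetD natE (d := 0) rfl).comp (hw.pair hx) :)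
  have h : CodeFP cE natE (fun p => ((EWT p.1).getD (p.2.2.1 + ΔT p.1 * p.2.1) []).getD p.2.2.2 0 + 4 ^ 140 * p.2.2.2) :=
    (natAdd.comp (hd.pair (natMul.comp ((const _ (4 ^ 140 : ℕ)).pair hx))) :)
  exact h.congr fun p => by unfold EposT; rfl

/-! ### The amplified functions -/

/-- Reading a listed bit at a binary position (default `false`). [folklore] -/
private theorem getBit : CodeFP (pairE (rawE bitE) natE) bitE (fun p => p.1.getD p.2 false) :=
  (rawGetOr bitE).comp ((fst _ _).pair ((snd _ _).pair (const _ false)))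

/-- **The query inputs on codes**: context `(t, k)`, arguments `(y, q)`. [cite: Hirahara2022PartialMCSP, proof of Lemma 8.1] -/
theorem codeFP_inpT : CodeFP (pairE (pairE toE natE) (pairE (rawE bitE) natE)) (rawE bitE)
    (fun p => inpT p.1.1 p.1.2 p.2.1 p.2.2) := by
  -- outer context `c = ((t, k), (y, q))`, item `rr`; inner context `(c, rr)`, item `cc`
  let cE : (TO × ℕ) × (List Bool × ℕ) → List Bool := pairE (pairE toE natE) (pairE (rawE bitE) natE)
  let dE : ((TO × ℕ) × (List Bool × ℕ)) × ℕ → List Bool := pairE cE natE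
  have dt : CodeFP dE toE (fun p => p.1.1.1) := (fst _ _).fst'.fst'
  have dk : CodeFP dE natE (fun p => p.1.1.2) := (fst _ _).fst'.snd'
  have dy : CodeFP dE (rawE bitE) (fun p => p.1.2.1) := (fst _ _).snd'.fst'
  have dq : CodeFP dE natE (fun p => p.1.2.2) := (fst _ _).snd'.snd'
  have drr : CodeFP dE natE (fun p => p.2) := snd _ _
  have dN : CodeFP dE unE (fun p => NT p.1.1.1 p.1.1.2) := (codeFP_NT.comp (dt.pair dk) :)
  have dm : CodeFP dE unE (fun p => mIT p.1.1.1) := (codeFP_mIT.comp dt :)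
  have d16N : CodeFP dE natE (fun p => NT p.1.1.1 p.1.1.2 * 4 ^ 2) := (natMul.comp ((natOfUn.comp dN).pair (const _ (4 ^ 2 : ℕ))) :)
  -- the inner item `cc`, context `p : dE`
  have ecc : CodeFP (pairE dE natE) unE (fun q => min q.2 (mIT q.1.1.1.1)) := (unOfNatMin.comp ((dm.comp (fst _ _)).pair (snd _ _)) :)
  have etb : CodeFP (pairE dE natE) bitE (fun q => q.1.1.2.2.testBit (min q.2 (mIT q.1.1.1.1))) :=
    (codeFP_testBit.comp ((dq.comp (fst _ _)).pair ecc) :)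
  have epos : CodeFP (pairE dE natE) natE (fun q => NT q.1.1.1.1 q.1.1.1.2 * 4 ^ 2 + (q.1.2 + q.2)) :=
    (natAdd.comp ((d16N.comp (fst _ _)).pair (natAdd.comp ((drr.comp (fst _ _)).pair (snd _ _)))) :)
  have ebit : CodeFP (pairE dE natE) bitE (fun q => q.1.1.2.1.getD (NT q.1.1.1.1 q.1.1.1.2 * 4 ^ 2 + (q.1.2 + q.2)) false) :=
    (getBit.comp ((dy.comp (fst _ _)).pair epos) :)
  have einner : CodeFP (pairE dE (rawE natE)) (rawE bitE) (fun q => q.2.map fun cc =>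
      q.1.1.2.2.testBit (min cc (mIT q.1.1.1.1)) && q.1.1.2.1.getD (NT q.1.1.1.1 q.1.1.1.2 * 4 ^ 2 + (q.1.2 + cc)) false) :=
    (map (etb.and ebit) :)
  have dpar : CodeFP dE bitE (fun p => parityT ((List.range (mIT p.1.1.1)).map fun cc =>
      p.1.2.2.testBit (min cc (mIT p.1.1.1)) && p.1.2.1.getD (NT p.1.1.1 p.1.1.2 * 4 ^ 2 + (p.2 + cc)) false)) :=
    (codeFP_parityT.comp (einner.comp ((CodeFP.id dE).pair (urange.comp dm))) :)
  -- the other two bits of item `rr`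
  have dx : CodeFP dE bitE (fun p => p.1.2.1.getD (eAposT p.1.1.1 p.1.1.2 p.1.2.2 p.2) false) :=
    (getBit.comp (dy.pair (codeFP_eAposT.comp ((dt.pair dk).pair (dq.pair drr)))) :)
  have dbpos : CodeFP dE natE (fun p => NT p.1.1.1 p.1.1.2 * 4 ^ 2 + ((NT p.1.1.1 p.1.1.2 + mIT p.1.1.1) + p.2)) :=
    (natAdd.comp (d16N.pair (natAdd.comp ((natOfUn.comp (unAdd.comp (dN.pair dm))).pair drr))) :)
  have db : CodeFP dE bitE (fun p => p.1.2.1.getD (NT p.1.1.1 p.1.1.2 * 4 ^ 2 + ((NT p.1.1.1 p.1.1.2 + mIT p.1.1.1) + p.2)) false) :=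
    (getBit.comp (dy.pair dbpos) :)
  have ditem := dx.xor (dpar.xor db)
  have h : CodeFP cE (rawE bitE) (fun c => (List.range (NT c.1.1 c.1.2)).map fun rr =>
      xor (c.2.1.getD (eAposT c.1.1 c.1.2 c.2.2 rr) false)
        (xor (parityT ((List.range (mIT c.1.1)).map fun cc =>
          c.2.2.testBit (min cc (mIT c.1.1)) && c.2.1.getD (NT c.1.1 c.1.2 * 4 ^ 2 + (rr + cc)) false))
          (c.2.1.getD (NT c.1.1 c.1.2 * 4 ^ 2 + ((NT c.1.1 c.1.2 + mIT c.1.1) + rr)) false))) :=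
    ((map ditem).comp ((CodeFP.id cE).pair (urange.comp (codeFP_NT.comp (fst _ _)))) :)
  refine h.congr fun c => ?_
  unfold inpT
  refine List.map_congr_left fun rr _ => ?_
  congr 2
  congr 1
  refine List.map_congr_left fun cc hcc => ?_
  rw [min_eq_left (List.mem_range.1 hcc).le]

/-- **The amplified functions on codes**: context `(t, r)`, arguments `(k, y)`. [cite: Hirahara2022PartialMCSP, proof of Lemma 8.1 (Amp^f)] -/
theorem codeFP_fhatT : CodeFP (pairE inE (pairE natE (rawE bitE))) bitE (fun p => fhatT p.1.1 p.1.2 p.2.1 p.2.2) := by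
  let cE : (TO × List Bool) × (ℕ × List Bool) → List Bool := pairE inE (pairE natE (rawE bitE))
  -- item `q`, context `c : cE`
  have qt : CodeFP (pairE cE natE) toE (fun s => s.1.1.1) := (fst _ _).fst'.fst'
  have qk : CodeFP (pairE cE natE) natE (fun s => s.1.2.1) := (fst _ _).snd'.fst'
  have qy : CodeFP (pairE cE natE) (rawE bitE) (fun s => s.1.2.2) := (fst _ _).snd'.snd'
  have qinp : CodeFP (pairE cE natE) (rawE bitE) (fun s => inpT s.1.1.1 s.1.2.1 s.1.2.2 s.2) :=
    (codeFP_inpT.comp ((qt.pair qk).pair (qy.pair (snd _ _))) :)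
  have qcoin : CodeFP (pairE cE natE) bitE (fun s => coinT s.1.1.1 s.1.1.2 s.1.2.1 (inpT s.1.1.1 s.1.2.1 s.1.2.2 s.2)) :=
    (codeFP_coinT.comp ((fst _ _).fst'.pair (qk.pair qinp)) :)
  have h : CodeFP cE bitE (fun c => parityT ((List.range (kAT c.1.1)).map fun q =>
      coinT c.1.1 c.1.2 c.2.1 (inpT c.1.1 c.2.1 c.2.2 q))) :=
    (codeFP_parityT.comp ((map qcoin).comp ((CodeFP.id cE).pair (urange.comp (codeFP_kAT.comp (fst _ _).fst')))) :)
  exact h.congr fun c => by unfold fhatT; rfl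

/-- **The NW blocks on codes**: context `t`, arguments `(z, (k, tt))`. [folklore] -/
theorem codeFP_blockT : CodeFP (pairE toE (pairE (rawE bitE) (pairE natE natE))) (rawE bitE)
    (fun p => blockT p.1 p.2.1 p.2.2.1 p.2.2.2) := by
  let cE : TO × (List Bool × (ℕ × ℕ)) → List Bool := pairE toE (pairE (rawE bitE) (pairE natE natE))
  have xt : CodeFP (pairE cE natE) toE (fun s => s.1.1) := (fst _ _).fst'
  have xpos : CodeFP (pairE cE natE) natE (fun s => EposT s.1.1 s.1.2.2.1 s.1.2.2.2 s.2) :=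
    (codeFP_EposT.comp (xt.pair (((fst _ _).snd'.snd'.fst').pair (((fst _ _).snd'.snd'.snd').pair (snd _ _)))) :)
  have xbit : CodeFP (pairE cE natE) bitE (fun s => s.1.2.1.getD (EposT s.1.1 s.1.2.2.1 s.1.2.2.2 s.2) false) :=
    (getBit.comp (((fst _ _).snd'.fst').pair xpos) :)
  have hr : CodeFP cE (rawE natE) (fun c => List.range (ℓT c.1)) := urange.comp (codeFP_ℓT.comp (fst _ _))
  have h : CodeFP cE (rawE bitE) (fun c => (List.range (ℓT c.1)).map fun x => c.2.1.getD (EposT c.1 c.2.2.1 c.2.2.2 x) false) :=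
    ((map xbit).comp ((CodeFP.id cE).pair hr) :)
  exact h.congr fun c => by unfold blockT; rfl

/-! ### Slots and the mask -/

/-- The kept formula `j` on codes. [folklore] -/
theorem codeFP_φT : CodeFP (pairE toE natE) fE (fun p => φT p.1 p.2) := by
  have h : CodeFP (pairE toE natE) fE (fun p => (keptT p.1).getD p.2 []) :=
    ((rawGetD fE (d := []) rfl).comp ((codeFP_keptT.comp (fst _ _)).pair (snd _ _)) :)
  exact h.congr fun p => by unfold φT; rfl

/-- `flatMap id` is `flatten`. [folklore] -/
private theorem flatMap_id_eq (l : List (List ℕ)) : l.flatMap id = l.flatten := by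
  induction l with
  | nil => rfl
  | cons a l ih => rw [List.flatMap_cons, List.flatten_cons, ih]; rfl

/-- The distinct variables on codes. [folklore] -/
theorem codeFP_varsT : CodeFP (pairE toE natE) (rawE natE) (fun p => varsT p.1 p.2) := by
  have h : CodeFP (pairE toE natE) (rawE natE) (fun p => ((φT p.1 p.2).flatten).dedup) :=
    (codeFP_dedup.comp ((flatten natE).comp codeFP_φT) :)
  exact h.congr fun p => by unfold varsT; rw [flatMap_id_eq]

/-- The slot variable `vars[s]` (or `0`) on codes: context `(t, j)`, argument `s`. [folklore] -/
theorem codeFP_slotVar : CodeFP (pairE (pairE toE natE) natE) natE (fun p => (varsT p.1.1 p.1.2).getD p.2 0) := by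
  have h : CodeFP (pairE (pairE toE natE) natE) natE (fun p => (varsT p.1.1 p.1.2).getD p.2 0) :=
    ((rawGetD natE (d := 0) rfl).comp ((codeFP_varsT.comp (fst _ _)).pair (snd _ _)) :)
  exact h

/-- The slot test `s < |vars| ∧ vars[s] < n` on codes. [folklore] -/
theorem codeFP_slotOk : CodeFP (pairE (pairE toE natE) natE) bitE
    (fun p => decide (p.2 < (varsT p.1.1 p.1.2).length) && decide ((varsT p.1.1 p.1.2).getD p.2 0 < nT p.1.1)) := by
  have h1 : CodeFP (pairE (pairE toE natE) natE) bitE (fun p => decide (p.2 < (varsT p.1.1 p.1.2).length)) :=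
    (natLt.comp ((snd _ _).pair ((natLength natE).comp (codeFP_varsT.comp (fst _ _)))) :)
  have h2 : CodeFP (pairE (pairE toE natE) natE) bitE (fun p => decide ((varsT p.1.1 p.1.2).getD p.2 0 < nT p.1.1)) :=
    (natLt.comp (codeFP_slotVar.pair (natOfUn.comp (codeFP_nT.comp (fst _ _).fst'))) :)
  exact h1.and h2

/-- The mask row without `Option`. [folklore] -/
theorem maskRowT_eq (t : TO) (r : List Bool) (j : ℕ) (z : List Bool) (s : ℕ) :
    maskRowT t r j z s =
      if decide (s < (varsT t j).length) && decide ((varsT t j).getD s 0 < nT t) then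
        (List.range (ΔT t)).map fun tt => fhatT t r ((varsT t j).getD s 0) (blockT t z ((varsT t j).getD s 0) tt)
      else List.replicate (ΔT t) false := by
  unfold maskRowT slotT
  by_cases h1 : s < (varsT t j).length
  · rw [if_pos h1, decide_eq_true h1, Bool.true_and]
    by_cases h2 : (varsT t j).getD s 0 < nT t
    · rw [if_pos h2, decide_eq_true h2, if_pos rfl]
    · rw [if_neg h2, decide_eq_false h2]; rfl
  · rw [if_neg h1, decide_eq_false h1, Bool.false_and]; rfl

/-- **The mask rows on codes**: context `((t, r), (j, z))`, argument `s`. [cite: Hirahara2022PartialMCSP, proof of Lemma 8.3] -/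
theorem codeFP_maskRowT : CodeFP (pairE (pairE inE (pairE natE (rawE bitE))) natE) (rawE bitE)
    (fun p => maskRowT p.1.1.1 p.1.1.2 p.1.2.1 p.1.2.2 p.2) := by
  let cE : ((TO × List Bool) × (ℕ × List Bool)) × ℕ → List Bool := pairE (pairE inE (pairE natE (rawE bitE))) natE
  have ct : CodeFP cE toE (fun p => p.1.1.1) := (fst _ _).fst'.fst'
  have ctr : CodeFP cE inE (fun p => p.1.1) := (fst _ _).fst'
  have cj : CodeFP cE natE (fun p => p.1.2.1) := (fst _ _).snd'.fst'
  have cz : CodeFP cE (rawE bitE) (fun p => p.1.2.2) := (fst _ _).snd'.snd'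
  have cs : CodeFP cE natE (fun p => p.2) := snd _ _
  have cok := (codeFP_slotOk.comp ((ct.pair cj).pair cs) :)
  have csv : CodeFP cE natE (fun p => (varsT p.1.1.1 p.1.2.1).getD p.2 0) := (codeFP_slotVar.comp ((ct.pair cj).pair cs) :)
  have cΔ : CodeFP cE unE (fun p => ΔT p.1.1.1) := codeFP_ΔTun.comp ct
  -- item `tt`, context `p : cE`
  have iblk : CodeFP (pairE cE natE) (rawE bitE)
      (fun q => blockT q.1.1.1.1 q.1.1.2.2 ((varsT q.1.1.1.1 q.1.1.2.1).getD q.1.2 0) q.2) :=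
    (codeFP_blockT.comp ((ct.comp (fst _ _)).pair ((cz.comp (fst _ _)).pair ((csv.comp (fst _ _)).pair (snd _ _)))) :)
  have ifh : CodeFP (pairE cE natE) bitE (fun q => fhatT q.1.1.1.1 q.1.1.1.2 ((varsT q.1.1.1.1 q.1.1.2.1).getD q.1.2 0)
      (blockT q.1.1.1.1 q.1.1.2.2 ((varsT q.1.1.1.1 q.1.1.2.1).getD q.1.2 0) q.2)) :=
    (codeFP_fhatT.comp ((ctr.comp (fst _ _)).pair ((csv.comp (fst _ _)).pair iblk)) :)
  have hthen : CodeFP cE (rawE bitE) (fun p => (List.range (ΔT p.1.1.1)).map fun tt =>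
      fhatT p.1.1.1 p.1.1.2 ((varsT p.1.1.1 p.1.2.1).getD p.2 0) (blockT p.1.1.1 p.1.2.2 ((varsT p.1.1.1 p.1.2.1).getD p.2 0) tt)) :=
    ((map ifh).comp ((CodeFP.id cE).pair (urange.comp cΔ)) :)
  have helse : CodeFP cE (rawE bitE) (fun p => List.replicate (ΔT p.1.1.1) false) :=
    ((replicateOf bitE).comp ((const _ false).pair cΔ) :)
  exact (cok.ite hthen helse).congr fun p => (maskRowT_eq _ _ _ _ _).symm

/-- **The mask on codes**: context `(t, r)`, arguments `(j, z)`. [cite: Hirahara2022PartialMCSP, proof of Lemma 8.3] -/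
theorem codeFP_maskT : CodeFP (pairE inE (pairE natE (rawE bitE))) (rawE (rawE bitE))
    (fun p => maskT p.1.1 p.1.2 p.2.1 p.2.2) := by
  have h : CodeFP (pairE inE (pairE natE (rawE bitE))) (rawE (rawE bitE))
      (fun c => (List.range (ΔT c.1.1)).map (maskRowT c.1.1 c.1.2 c.2.1 c.2.2)) :=
    ((map codeFP_maskRowT).comp ((CodeFP.id _).pair (urange.comp (codeFP_ΔTun.comp (fst _ _).fst'))) :)
  exact h.congr fun c => by unfold maskT; rfl

/-! ### Shares -/

/-- The share context `(φ, (b, rbits))`. [folklore] -/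
abbrev shE : MonotoneDNF × (Bool × List Bool) → List Bool := pairE fE (pairE bitE (rawE bitE))

/-- **The sharing coins on codes**: context `(φ, (b, rbits))`, arguments `(k', p)`. [cite: Hirahara2022PartialMCSP, Lemma 4.5] -/
theorem codeFP_rbitT : CodeFP (pairE shE (pairE natE natE)) bitE (fun q => rbitT q.1.1 q.1.2.2 q.2.1 q.2.2) := by
  let cE : (MonotoneDNF × (Bool × List Bool)) × (ℕ × ℕ) → List Bool := pairE shE (pairE natE natE)
  have cφ : CodeFP cE fE (fun q => q.1.1) := (fst _ _).fst'
  have crb : CodeFP cE (rawE bitE) (fun q => q.1.2.2) := (fst _ _).snd'.snd'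
  have ck : CodeFP cE natE (fun q => q.2.1) := (snd _ _).fst'
  have cp : CodeFP cE natE (fun q => q.2.2) := (snd _ _).snd'
  have cL : CodeFP cE natE (fun q => numLitT q.1.1) := (natOfUn.comp (codeFP_numLitT.comp cφ) :)
  have ccond : CodeFP cE bitE (fun q => decide (q.2.1 < q.1.1.length) && decide (q.2.2 < numLitT q.1.1)) :=
    ((natLt.comp (ck.pair ((natLength (rawE natE)).comp cφ))).and (natLt.comp (cp.pair cL)) :)
  have cidx : CodeFP cE natE (fun q => q.2.2 + numLitT q.1.1 * q.2.1) := (natAdd.comp (cp.pair (natMul.comp (cL.pair ck))) :)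
  have cbit : CodeFP cE bitE (fun q => q.1.2.2.getD (q.2.2 + numLitT q.1.1 * q.2.1) false) := (getBit.comp (crb.pair cidx) :)
  have h : CodeFP cE bitE (fun q => if decide (q.2.1 < q.1.1.length) && decide (q.2.2 < numLitT q.1.1) then
      q.1.2.2.getD (q.2.2 + numLitT q.1.1 * q.2.1) false else false) := (ccond.ite cbit (const _ false) :)
  exact h.congr fun q => by
    unfold rbitT; rw [numLitT_eq]
    by_cases hc : q.2.1 < q.1.1.length ∧ q.2.2 < q.1.1.numLiterals
    · rw [if_pos hc, decide_eq_true hc.1, decide_eq_true hc.2, Bool.true_and, if_pos rfl]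
    · rw [if_neg hc]
      have : (decide (q.2.1 < q.1.1.length) && decide (q.2.2 < q.1.1.numLiterals)) = false := by
        simpa [Bool.and_eq_false_iff, not_and_or] using hc
      rw [this]; rfl

/-- The length of term `k'` on codes (unary): `(φ, k') ↦ termLen`. [folklore] -/
theorem codeFP_termLen : CodeFP (pairE fE natE) unE (fun q => q.1.termLen q.2) := by
  have h : CodeFP (pairE fE natE) unE (fun q => (q.1.getD q.2 []).length) :=
    ((ulength natE).comp ((rawGetD (rawE natE) (d := []) rfl).comp ((fst _ _).pair (snd _ _))) :)
  exact h.congr fun q => rfl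

/-- **The share symbols on codes**: context `(φ, (b, rbits))`, argument `(k', p)`. [cite: Hirahara2022PartialMCSP, Lemma 4.5] -/
theorem codeFP_symbolT : CodeFP (pairE shE (pairE natE natE)) bitE (fun q => symbolT q.1.1 q.1.2.1 q.1.2.2 q.2) := by
  let cE : (MonotoneDNF × (Bool × List Bool)) × (ℕ × ℕ) → List Bool := pairE shE (pairE natE natE)
  have cφ : CodeFP cE fE (fun q => q.1.1) := (fst _ _).fst'
  have cb : CodeFP cE bitE (fun q => q.1.2.1) := (fst _ _).snd'.fst'
  have ck : CodeFP cE natE (fun q => q.2.1) := (snd _ _).fst'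
  have cp : CodeFP cE natE (fun q => q.2.2) := (snd _ _).snd'
  -- the positions `1 ≤ p' < |term k'|`
  have crange : CodeFP cE (rawE natE) (fun q => List.range (q.1.1.termLen q.2.1)) := urange.comp (codeFP_termLen.comp (cφ.pair ck))
  have cfilt : CodeFP cE (rawE natE) (fun q => (List.range (q.1.1.termLen q.2.1)).filter fun p' => decide (1 ≤ p')) :=
    ((CodeFP.filter (σ := (MonotoneDNF × (Bool × List Bool)) × (ℕ × ℕ)) (eσ := cE)
      ((natLe.comp ((const _ (1 : ℕ)).pair (snd cE natE))) :)).comp ((CodeFP.id cE).pair crange) :)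
  -- the coins at those positions, item `p'`, context `q : cE`
  have irb : CodeFP (pairE cE natE) bitE (fun w => rbitT w.1.1.1 w.1.1.2.2 w.1.2.1 w.2) :=
    (codeFP_rbitT.comp (((fst _ _).fst').pair ((ck.comp (fst _ _)).pair (snd _ _))) :)
  have cbits : CodeFP cE (rawE bitE) (fun q => ((List.range (q.1.1.termLen q.2.1)).filter fun p' => decide (1 ≤ p')).map
      (rbitT q.1.1 q.1.2.2 q.2.1)) := ((map irb).comp ((CodeFP.id cE).pair cfilt) :)
  have cpar : CodeFP cE bitE (fun q => xor q.1.2.1 (parityT (((List.range (q.1.1.termLen q.2.1)).filter fun p' => decide (1 ≤ p')).map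
      (rbitT q.1.1 q.1.2.2 q.2.1)))) := cb.xor (codeFP_parityT.comp cbits)
  have cown : CodeFP cE bitE (fun q => rbitT q.1.1 q.1.2.2 q.2.1 q.2.2) := (codeFP_rbitT.comp ((fst _ _).pair (ck.pair cp)) :)
  have czero : CodeFP cE bitE (fun q => decide (q.2.2 = 0)) := (natEq.comp (cp.pair (const _ (0 : ℕ))) :)
  have h := czero.ite cpar cown
  exact h.congr fun q => by
    unfold symbolT
    by_cases h0 : q.2.2 = 0
    · rw [if_pos h0, decide_eq_true h0, if_pos rfl]
    · rw [if_neg h0, decide_eq_false h0]; rfl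

/-- The variable of an occurrence on codes: `(φ, (k', p)) ↦ varAt`. [folklore] -/
theorem codeFP_varAt : CodeFP (pairE fE (pairE natE natE)) natE (fun q => q.1.varAt q.2) := by
  have h : CodeFP (pairE fE (pairE natE natE)) natE (fun q => (q.1.getD q.2.1 []).getD q.2.2 0) :=
    ((rawGetD natE (d := 0) rfl).comp (((rawGetD (rawE natE) (d := []) rfl).comp ((fst _ _).pair (snd _ _).fst')).pair
      (snd _ _).snd') :)
  exact h.congr fun q => rfl

/-- The occurrences on codes: `φ ↦ occs φ`. [folklore] -/
theorem codeFP_occs : CodeFP fE (rawE (pairE natE natE)) MonotoneDNF.occs := by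
  -- item `k'` (context `φ`), inner item `p` (context `(φ, k')`)
  have ipair : CodeFP (pairE (pairE fE natE) natE) (pairE natE natE) (fun w => (w.1.2, w.2)) := ((fst _ _).snd').pair (snd _ _)
  have iblock : CodeFP (pairE fE natE) (rawE (pairE natE natE)) (fun q => (List.range (q.1.termLen q.2)).map fun p => (q.2, p)) :=
    ((map ipair).comp ((CodeFP.id _).pair (urange.comp codeFP_termLen)) :)
  have hblocks : CodeFP fE (rawE (rawE (pairE natE natE)))
      (fun φ => (List.range φ.length).map fun k' => (List.range (φ.termLen k')).map fun p => (k', p)) :=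
    ((map iblock).comp ((CodeFP.id fE).pair (urange.comp (ulength (rawE natE)))) :)
  have h := (flatten (pairE natE natE)).comp hblocks
  exact h.congr fun φ => by unfold MonotoneDNF.occs; rw [List.flatMap_def]

/-- The occurrences of a variable on codes: `(φ, i) ↦ occsOf φ i`. [folklore] -/
theorem codeFP_occsOf : CodeFP (pairE fE natE) (rawE (pairE natE natE)) (fun q => q.1.occsOf q.2) := by
  have htest : CodeFP (pairE (pairE fE natE) (pairE natE natE)) bitE (fun w => decide (w.1.1.varAt w.2 = w.1.2)) :=
    (natEq.comp ((codeFP_varAt.comp (((fst _ _).fst').pair (snd _ _))).pair (fst _ _).snd') :)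
  have h : CodeFP (pairE fE natE) (rawE (pairE natE natE)) (fun q => q.1.occs.filter fun kp => decide (q.1.varAt kp = q.2)) :=
    ((CodeFP.filter htest).comp ((CodeFP.id _).pair (codeFP_occs.comp (fst _ _))) :)
  exact h.congr fun q => rfl

/-- **The shares on codes**: context `(φ, (b, rbits))`, argument `i`. [cite: Hirahara2022PartialMCSP, Lemma 4.5] -/
theorem codeFP_shareT : CodeFP (pairE shE natE) (rawE bitE) (fun q => shareT q.1.1 q.1.2.1 q.1.2.2 q.2) := by
  have hocc : CodeFP (pairE shE natE) (rawE (pairE natE natE)) (fun q => q.1.1.occsOf q.2) :=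
    (codeFP_occsOf.comp (((fst _ _).fst').pair (snd _ _)) :)
  have h : CodeFP (pairE shE natE) (rawE bitE) (fun q => (q.1.1.occsOf q.2).map (symbolT q.1.1 q.1.2.1 q.1.2.2)) :=
    ((map codeFP_symbolT).comp ((fst _ _).pair hocc) :)
  exact h.congr fun q => rfl

/-- The share row without `Option`. [folklore] -/
theorem shareRowT_eq (t : TO) (j : ℕ) (b : Bool) (rbits : List Bool) (s : ℕ) :
    (match slotT t j s with
      | some k => (List.range (ΔT t)).map fun tt => (shareT (φT t j) b rbits k).getD tt false
      | none => List.replicate (ΔT t) false) =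
      if decide (s < (varsT t j).length) && decide ((varsT t j).getD s 0 < nT t) then
        (List.range (ΔT t)).map fun tt => (shareT (φT t j) b rbits ((varsT t j).getD s 0)).getD tt false
      else List.replicate (ΔT t) false := by
  unfold slotT
  by_cases h1 : s < (varsT t j).length
  · rw [if_pos h1, decide_eq_true h1, Bool.true_and]
    by_cases h2 : (varsT t j).getD s 0 < nT t
    · rw [if_pos h2, decide_eq_true h2, if_pos rfl]
    · rw [if_neg h2, decide_eq_false h2]; rfl
  · rw [if_neg h1, decide_eq_false h1, Bool.false_and]; rfl

/-- **The share vectors on codes**: context `(t, j)`, arguments `(b, rbits)`. [cite: Hirahara2022PartialMCSP, proof of Lemma 8.3] -/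
theorem codeFP_shareVecT : CodeFP (pairE (pairE toE natE) (pairE bitE (rawE bitE))) (rawE (rawE bitE))
    (fun p => shareVecT p.1.1 p.1.2 p.2.1 p.2.2) := by
  -- row `s`, context `c = ((t, j), (b, rbits))`
  let cE : (TO × ℕ) × (Bool × List Bool) → List Bool := pairE (pairE toE natE) (pairE bitE (rawE bitE))
  let rE : ((TO × ℕ) × (Bool × List Bool)) × ℕ → List Bool := pairE cE natE
  have rt : CodeFP rE toE (fun w => w.1.1.1) := (fst _ _).fst'.fst'
  have rtj : CodeFP rE (pairE toE natE) (fun w => w.1.1) := (fst _ _).fst'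
  have rs : CodeFP rE natE (fun w => w.2) := snd _ _
  have rok := (codeFP_slotOk.comp (rtj.pair rs) :)
  have rsv : CodeFP rE natE (fun w => (varsT w.1.1.1 w.1.1.2).getD w.2 0) := (codeFP_slotVar.comp (rtj.pair rs) :)
  have rsh : CodeFP rE (rawE bitE) (fun w => shareT (φT w.1.1.1 w.1.1.2) w.1.2.1 w.1.2.2 ((varsT w.1.1.1 w.1.1.2).getD w.2 0)) :=
    (codeFP_shareT.comp (((codeFP_φT.comp rtj).pair (fst _ _).snd').pair rsv) :)
  have rΔ : CodeFP rE unE (fun w => ΔT w.1.1.1) := codeFP_ΔTun.comp rt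
  -- entry `tt`, context `w : rE`
  have ient : CodeFP (pairE rE natE) bitE (fun v => (shareT (φT v.1.1.1.1 v.1.1.1.2) v.1.1.2.1 v.1.1.2.2
      ((varsT v.1.1.1.1 v.1.1.1.2).getD v.1.2 0)).getD v.2 false) := (getBit.comp ((rsh.comp (fst _ _)).pair (snd _ _)) :)
  have rthen : CodeFP rE (rawE bitE) (fun w => (List.range (ΔT w.1.1.1)).map fun tt =>
      (shareT (φT w.1.1.1 w.1.1.2) w.1.2.1 w.1.2.2 ((varsT w.1.1.1 w.1.1.2).getD w.2 0)).getD tt false) :=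
    ((map ient).comp ((CodeFP.id rE).pair (urange.comp rΔ)) :)
  have relse : CodeFP rE (rawE bitE) (fun w => List.replicate (ΔT w.1.1.1) false) := ((replicateOf bitE).comp ((const _ false).pair rΔ) :)
  have rrow := rok.ite rthen relse
  have h : CodeFP cE (rawE (rawE bitE)) (fun c => (List.range (ΔT c.1.1)).map fun s =>
      if decide (s < (varsT c.1.1 c.1.2).length) && decide ((varsT c.1.1 c.1.2).getD s 0 < nT c.1.1) then
        (List.range (ΔT c.1.1)).map fun tt => (shareT (φT c.1.1 c.1.2) c.2.1 c.2.2 ((varsT c.1.1 c.1.2).getD s 0)).getD tt false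
      else List.replicate (ΔT c.1.1) false) :=
    ((map rrow).comp ((CodeFP.id cE).pair (urange.comp (codeFP_ΔTun.comp (fst _ _).fst'))) :)
  exact h.congr fun c => by
    unfold shareVecT
    exact List.map_congr_left fun s _ => (shareRowT_eq _ _ _ _ _).symm

/-! ### The search over sharing coins -/

/-- **All bit lists within the budget**: `(u, L) ↦ allBitsT u L` (`u, L` unary). [folklore] -/
theorem codeFP_allBitsT : CodeFP (pairE unE unE) (rawE (rawE bitE)) (fun p => allBitsT p.1 p.2) := by
  -- item `i` (binary), context `(u, L)`; entry `p` (binary), context `((u, L), i)`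
  have ep : CodeFP (pairE (pairE (pairE unE unE) natE) natE) unE (fun v => min v.2 v.1.1.2) :=
    (unOfNatMin.comp (((fst _ _).fst'.snd').pair (snd _ _)) :)
  have ebit : CodeFP (pairE (pairE (pairE unE unE) natE) natE) bitE (fun v => v.1.2.testBit (min v.2 v.1.1.2)) :=
    (codeFP_testBit.comp (((fst _ _).snd').pair ep) :)
  have irow : CodeFP (pairE (pairE unE unE) natE) (rawE bitE) (fun w => (List.range w.1.2).map fun p => w.2.testBit (min p w.1.2)) :=
    ((map ebit).comp ((CodeFP.id _).pair (urange.comp (fst _ _).snd')) :)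
  have irow' : CodeFP (pairE (pairE unE unE) natE) (rawE bitE) (fun w => (List.range w.1.2).map fun p => w.2.testBit p) :=
    irow.congr fun w => List.map_congr_left fun p hp => by rw [min_eq_left (List.mem_range.1 hp).le]
  have hrange : CodeFP (pairE unE unE) (rawE natE) (fun p => List.range (min (2 ^ p.2) p.1)) :=
    (rangeOf.comp ((fst _ _).pair (natPow.comp ((const _ (2 : ℕ)).pair (snd _ _)))) :)
  have h : CodeFP (pairE unE unE) (rawE (rawE bitE)) (fun p => (List.range (min (2 ^ p.2) p.1)).map fun i =>
      (List.range p.2).map fun q => i.testBit q) := ((map irow').comp ((CodeFP.id _).pair hrange) :)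
  exact h.congr fun p => by unfold allBitsT; rfl

/-- The number of sharing coins (unary): `(t, j) ↦ nCoinsT t j`. [folklore] -/
theorem codeFP_nCoinsT : CodeFP (pairE toE natE) unE (fun p => nCoinsT p.1 p.2) := by
  have h : CodeFP (pairE toE natE) unE (fun p => (φT p.1 p.2).length * numLitT (φT p.1 p.2)) :=
    (unMul.comp (((ulength (rawE natE)).comp codeFP_φT).pair (codeFP_numLitT.comp codeFP_φT)) :)
  exact h.congr fun p => by unfold nCoinsT; rw [numLitT_eq]

/-- **The share search on codes**: context `(t, j)`, arguments `(b, target)`. [cite: Hirahara2022PartialMCSP, proof of Thm. 8.5] -/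
theorem codeFP_hasShareT : CodeFP (pairE (pairE toE natE) (pairE bitE (rawE (rawE bitE)))) bitE
    (fun p => hasShareT p.1.1 p.1.2 p.2.1 p.2.2) := by
  let cE : (TO × ℕ) × (Bool × List (List Bool)) → List Bool := pairE (pairE toE natE) (pairE bitE (rawE (rawE bitE)))
  -- item `rbits`, context `c : cE`
  have isv : CodeFP (pairE cE (rawE bitE)) (rawE (rawE bitE)) (fun w => shareVecT w.1.1.1 w.1.1.2 w.1.2.1 w.2) :=
    (codeFP_shareVecT.comp (((fst _ _).fst').pair (((fst _ _).snd'.fst').pair (snd _ _))) :)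
  have itest : CodeFP (pairE cE (rawE bitE)) bitE (fun w => decide (shareVecT w.1.1.1 w.1.1.2 w.1.2.1 w.2 = w.1.2.2)) :=
    ((CodeFP.eq (rawE_injective (rawE_injective bitE_injective))).comp (isv.pair (fst _ _).snd'.snd') :)
  have hall : CodeFP cE (rawE (rawE bitE)) (fun c => allBitsT (budgetT c.1.1) (nCoinsT c.1.1 c.1.2)) :=
    (codeFP_allBitsT.comp ((codeFP_budgetT.comp (fst _ _).fst').pair (codeFP_nCoinsT.comp (fst _ _))) :)
  have h : CodeFP cE bitE (fun c => (allBitsT (budgetT c.1.1) (nCoinsT c.1.1 c.1.2)).any fun rbits =>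
      decide (shareVecT c.1.1 c.1.2 c.2.1 rbits = c.2.2)) := ((any itest).comp ((CodeFP.id cE).pair hall) :)
  exact h.congr fun c => by unfold hasShareT; rfl

/-- **Row-wise XOR on codes.** [folklore] -/
theorem codeFP_xorRowsT : CodeFP (pairE (rawE (rawE bitE)) (rawE (rawE bitE))) (rawE (rawE bitE)) (fun p => xorRowsT p.1 p.2) := by
  have hinner : CodeFP (pairE unitE (pairE (rawE bitE) (rawE bitE))) (rawE bitE) (fun w => List.zipWith xor w.2.1 w.2.2) :=
    ((zipWith (σ := Unit) (eσ := unitE) (g := fun v : Unit × Bool × Bool => xor v.2.1 v.2.2)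
      (xorBit.comp (((snd _ _).fst').pair (snd _ _).snd'))) :)
  have hinner' : CodeFP (pairE unitE (pairE (rawE bitE) (rawE bitE))) (rawE bitE) (fun w => List.zipWith xor w.2.1 w.2.2) := hinner
  have houter : CodeFP (pairE unitE (pairE (rawE (rawE bitE)) (rawE (rawE bitE)))) (rawE (rawE bitE))
      (fun w => List.zipWith (fun u v => List.zipWith xor u v) w.2.1 w.2.2) :=
    ((zipWith (σ := Unit) (eσ := unitE) (g := fun v : Unit × List Bool × List Bool => List.zipWith xor v.2.1 v.2.2)
      (hinner'.comp ((fst _ _).pair (((snd _ _).fst').pair (snd _ _).snd')))) :)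
  have h : CodeFP (pairE (rawE (rawE bitE)) (rawE (rawE bitE))) (rawE (rawE bitE))
      (fun p => List.zipWith (fun u v => List.zipWith xor u v) p.1 p.2) := (houter.comp ((const _ ()).pair (CodeFP.id _)) :)
  exact h.congr fun p => rfl

/-! ### The table -/

/-- **The formula field on codes**: `(t, i) ↦ i mod 2^{Lj}`. [folklore] -/
theorem codeFP_jOfT : CodeFP (pairE toE natE) natE (fun p => jOfT p.1 p.2) := by
  have h : CodeFP (pairE toE natE) natE (fun p => p.2 % 2 ^ LjT p.1) :=
    (natMod.comp ((snd _ _).pair (natPow.comp ((const _ (2 : ℕ)).pair (codeFP_LjT.comp (fst _ _))))) :)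
  exact h.congr fun p => by unfold jOfT; rfl

/-- **The seed field on codes**: `(t, i) ↦ zOfT t i`. [folklore] -/
theorem codeFP_zOfT : CodeFP (pairE toE natE) (rawE bitE) (fun p => zOfT p.1 p.2) := by
  -- item `q` (binary), context `(t, i)`; position `Lj + min q d` in unary
  have ipos : CodeFP (pairE (pairE toE natE) natE) unE (fun w => LjT w.1.1 + min w.2 (dNWT w.1.1)) :=
    (unAdd.comp ((codeFP_LjT.comp (fst _ _).fst').pair (unOfNatMin.comp ((codeFP_dNWT.comp (fst _ _).fst').pair (snd _ _)))) :)
  have ibit : CodeFP (pairE (pairE toE natE) natE) bitE (fun w => w.1.2.testBit (LjT w.1.1 + min w.2 (dNWT w.1.1))) :=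
    (codeFP_testBit.comp (((fst _ _).snd').pair ipos) :)
  have h : CodeFP (pairE toE natE) (rawE bitE) (fun p => (List.range (dNWT p.1)).map fun q => p.2.testBit (LjT p.1 + min q (dNWT p.1))) :=
    ((map ibit).comp ((CodeFP.id _).pair (urange.comp (codeFP_dNWT.comp (fst _ _)))) :)
  exact h.congr fun p => by
    unfold zOfT
    exact List.map_congr_left fun q hq => by rw [min_eq_left (List.mem_range.1 hq).le]

/-- **The slot field on codes**: `(t, i) ↦ ξOfT t i`. [folklore] -/
theorem codeFP_ξOfT : CodeFP (pairE toE natE) (rawE (rawE bitE)) (fun p => ξOfT p.1 p.2) := by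
  -- row `s`, context `(t, i)`; entry `tt`, context `((t, i), s)`; position `Lj + (d + (min tt Δ + Δ · min s Δ))`
  let rE : (TO × ℕ) × ℕ → List Bool := pairE (pairE toE natE) natE
  have et : CodeFP (pairE rE natE) toE (fun v => v.1.1.1) := (fst _ _).fst'.fst'
  have eΔ : CodeFP (pairE rE natE) unE (fun v => ΔT v.1.1.1) := codeFP_ΔTun.comp et
  have es : CodeFP (pairE rE natE) unE (fun v => min v.1.2 (ΔT v.1.1.1)) := (unOfNatMin.comp (eΔ.pair (fst _ _).snd') :)
  have ett : CodeFP (pairE rE natE) unE (fun v => min v.2 (ΔT v.1.1.1)) := (unOfNatMin.comp (eΔ.pair (snd _ _)) :)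
  have epos : CodeFP (pairE rE natE) unE (fun v => LjT v.1.1.1 + (dNWT v.1.1.1 + (min v.2 (ΔT v.1.1.1) + ΔT v.1.1.1 * min v.1.2 (ΔT v.1.1.1)))) :=
    (unAdd.comp ((codeFP_LjT.comp et).pair (unAdd.comp ((codeFP_dNWT.comp et).pair (unAdd.comp (ett.pair (unMul.comp (eΔ.pair es))))))) :)
  have ebit : CodeFP (pairE rE natE) bitE (fun v => v.1.1.2.testBit
      (LjT v.1.1.1 + (dNWT v.1.1.1 + (min v.2 (ΔT v.1.1.1) + ΔT v.1.1.1 * min v.1.2 (ΔT v.1.1.1))))) :=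
    (codeFP_testBit.comp (((fst _ _).fst'.snd').pair epos) :)
  have rrow : CodeFP rE (rawE bitE) (fun w => (List.range (ΔT w.1.1)).map fun tt => w.1.2.testBit
      (LjT w.1.1 + (dNWT w.1.1 + (min tt (ΔT w.1.1) + ΔT w.1.1 * min w.2 (ΔT w.1.1))))) :=
    ((map ebit).comp ((CodeFP.id rE).pair (urange.comp (codeFP_ΔTun.comp (fst _ _).fst'))) :)
  have h : CodeFP (pairE toE natE) (rawE (rawE bitE)) (fun p => (List.range (ΔT p.1)).map fun s => (List.range (ΔT p.1)).map fun tt =>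
      p.2.testBit (LjT p.1 + (dNWT p.1 + (min tt (ΔT p.1) + ΔT p.1 * min s (ΔT p.1))))) :=
    ((map rrow).comp ((CodeFP.id _).pair (urange.comp (codeFP_ΔTun.comp (fst _ _)))) :)
  exact h.congr fun p => by
    unfold ξOfT
    refine List.map_congr_left fun s hs => List.map_congr_left fun tt htt => ?_
    rw [min_eq_left (List.mem_range.1 hs).le, min_eq_left (List.mem_range.1 htt).le]

/-- **The table value on codes**: context `(t, r)`, argument `i`. [cite: Hirahara2022PartialMCSP, proof of Thm. 8.5 (MCSP* case)] -/
theorem codeFP_PTvalT : CodeFP (pairE inE natE) optE (fun p => PTvalT p.1.1 p.1.2 p.2) := by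
  let cE : (TO × List Bool) × ℕ → List Bool := pairE inE natE
  have ct : CodeFP cE toE (fun p => p.1.1) := (fst _ _).fst'
  have ci : CodeFP cE natE (fun p => p.2) := snd _ _
  have cj : CodeFP cE natE (fun p => jOfT p.1.1 p.2) := (codeFP_jOfT.comp (ct.pair ci) :)
  have ccond : CodeFP cE bitE (fun p => decide (jOfT p.1.1 p.2 < νT p.1.1)) := (natLt.comp (cj.pair (natOfUn.comp (codeFP_νT.comp ct))) :)
  have cz : CodeFP cE (rawE bitE) (fun p => zOfT p.1.1 p.2) := (codeFP_zOfT.comp (ct.pair ci) :)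
  have cξ : CodeFP cE (rawE (rawE bitE)) (fun p => ξOfT p.1.1 p.2) := (codeFP_ξOfT.comp (ct.pair ci) :)
  have cmask : CodeFP cE (rawE (rawE bitE)) (fun p => maskT p.1.1 p.1.2 (jOfT p.1.1 p.2) (zOfT p.1.1 p.2)) :=
    (codeFP_maskT.comp ((fst _ _).pair (cj.pair cz)) :)
  have ctarget : CodeFP cE (rawE (rawE bitE)) (fun p => xorRowsT (ξOfT p.1.1 p.2) (maskT p.1.1 p.1.2 (jOfT p.1.1 p.2) (zOfT p.1.1 p.2))) :=
    (codeFP_xorRowsT.comp (cξ.pair cmask) :)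
  have chas : ∀ b : Bool, CodeFP cE bitE (fun p => hasShareT p.1.1 (jOfT p.1.1 p.2) b
      (xorRowsT (ξOfT p.1.1 p.2) (maskT p.1.1 p.1.2 (jOfT p.1.1 p.2) (zOfT p.1.1 p.2)))) := fun b =>
    (codeFP_hasShareT.comp ((ct.pair cj).pair ((const _ b).pair ctarget)) :)
  have hinner : CodeFP cE optE (fun p =>
      if hasShareT p.1.1 (jOfT p.1.1 p.2) true (xorRowsT (ξOfT p.1.1 p.2) (maskT p.1.1 p.1.2 (jOfT p.1.1 p.2) (zOfT p.1.1 p.2))) then some true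
      else if hasShareT p.1.1 (jOfT p.1.1 p.2) false (xorRowsT (ξOfT p.1.1 p.2) (maskT p.1.1 p.1.2 (jOfT p.1.1 p.2) (zOfT p.1.1 p.2)))
        then some false else none) :=
    ((chas true).ite (const _ (some true)) ((chas false).ite (const _ (some false)) (const _ (none : Option Bool))) :)
  have h := ccond.ite hinner (const _ (none : Option Bool))
  exact h.congr fun p => by
    unfold PTvalT
    by_cases hj : jOfT p.1.1 p.2 < νT p.1.1
    · rw [if_pos hj, decide_eq_true hj, if_pos rfl]
    · rw [if_neg hj, decide_eq_false hj]; rfl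

/-- **The table on codes**: `(t, r) ↦ tableT t r`. [cite: Hirahara2022PartialMCSP, proof of Thm. 8.5] -/
theorem codeFP_tableT : CodeFP inE (rawE optE) (fun p => tableT p.1 p.2) := by
  have hrange : CodeFP inE (rawE natE) (fun p => List.range (min (2 ^ LxT p.1) (budgetT p.1))) :=
    (rangeOf.comp ((codeFP_budgetT.comp (fst _ _)).pair (natPow.comp ((const _ (2 : ℕ)).pair (codeFP_LxT.comp (fst _ _))))) :)
  have h : CodeFP inE (rawE optE) (fun p => (List.range (min (2 ^ LxT p.1) (budgetT p.1))).map (PTvalT p.1 p.2)) :=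
    ((map codeFP_PTvalT).comp ((CodeFP.id inE).pair hrange) :)
  exact h.congr fun p => by unfold tableT; rfl

/-- Unfolding `mainOutT`. [folklore] -/
private theorem mainOutT_def (t : TO) (r : List Bool) : mainOutT t r = boolPair (listE optE (tableT t r)) (encodeNat (sPT t)) := by
  rw [mainOutT]

/-- `strE` is the identity (a generic rewrite, so that the kernel never weighs `id` against a large
definition). [folklore] -/
private theorem strE_apply (x : List Bool) : strE x = x := rfl

/-- **The main output on codes** (as a string): `(t, r) ↦ mainOutT t r`. [cite: Hirahara2022PartialMCSP, proof of Thm. 8.5 (output (f, s_P))] -/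
theorem codeFP_mainOutT : CodeFP inE strE (fun p => mainOutT p.1 p.2) := by
  have h1 : CodeFP inE (listE optE) (fun p => tableT p.1 p.2) := ((listOfRaw optE).comp codeFP_tableT).congr fun p => id_eq _
  have h : CodeFP inE (pairE (listE optE) natE) (fun p => (tableT p.1 p.2, sPT p.1)) := (h1.pair (codeFP_sPT.comp (fst _ _)) :)
  exact h.recodeOut fun p => by rw [strE_apply, mainOutT_def]; rfl

end HiraharaMachine

end Literature.Computability.Complexity
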